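import Literature.NumberTheory.EllipticCurves.Kato2004.IwasawaCohomologyLevelZero
import Literature.NumberTheory.EllipticCurves.IwasawaEulerCharProofs
import HarnessLib

/-!
# Kato 2004 (Astérisque 295) (12.2.1), Thm. 12.4 (1) and §14.14 (14.14.1) along the cyclotomic
# `ℤ_p`-extension: Kato's `𝐇²_Γ(T_pW) = lim← H²(ℤ_n[1/p], T_pW) = H²(ℤ[1/p], T_pW ⊗ Λ)` with its
# DESCENT SEQUENCE `0 → 𝐇¹_Γ/T𝐇¹_Γ → H¹(ℤ[1/p], T_pW) → 𝐇²_Γ[T] → 0` on the PINNED pair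
# (`𝐇¹_Γ(T_pW)`, `H¹(ℤ[1/p], T_pW)`) — ONE hypothesis structure + ONE existence fact (D-0014)

Topic `NumberTheory/EllipticCurves`, sub-directory `Kato2004` (namespace = path). Cell `bsd-cn100`,
typer seat `bsd-cn100-ty` (g7); target (a) of the cell plan (D0074-bsd-cn100-seats §6 add. 5): the
one named fact that the definition items `defn-IsKatoDescentDatumOf` / `defn-HasLocPKummerLog` of the
KATO–ZETA ROAD to crux B of the routes `CongruentShaFreeCut` (S2, `E_n : y² = x³ − n²x` at `p = 2`) and
`MordellShaFreeCut` (S2b, `x³ + y³ = p` at `p = 3`) need for the `H²`-SIDE of Kato's descent datum.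

WHY THIS FILE (honest framing).  The Summits-side interface
`Summit.BirchSwinnertonDyer.Rank1Residual.Additive.KatoDescentDatum p` (cell `bsd-potss`) names Kato's
§14.14 data `(H = 𝐇¹(T)⁰, z, H2 = 𝐇²(T)⁰, A = H¹(ℤ[1/p], T), ι, π)` as ABSTRACT `Λ`-modules, and the road
file `Summits/…/Theorems/CongruentShaFreeCutKatoZetaRoad.lean` consumes, over a free interface predicate
`IsOf W p D`, the readings (R) "a datum exists", (3.1') "`rank E(ℚ) = 1 ∧ #Ш(E)[p^∞] < ∞ ⟹ H2/T·H2`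
finite", (K) Kato's main conjecture up to powers of `p` on `(H2, H/Λz)`.  The `H¹`-side of the datum IS
in the tree (`IwasawaH1Data` = `𝐇¹_Γ(T_pW)` pinned levelwise, `integralH1` = `H¹(ℤ_n[1/p], T_pW)`,
`IwasawaH1Data.projZero`, the zeta lifts of `IwasawaCohomologyZetaLift` / `…EulerSystemLift`); the
`H²`-side is NOT an object of the tree anywhere (no corestriction in degree `2`; `DivisibilityInputs.H2`,
`MemberHullInputs.H2`, `KatoDescentDatum.H2` are abstract fields).  So "Kato's `𝐇²`" can only enter as
it does in the reviewed packages `Kato2004/DivisibilityInputs.lean` (cell `bsd-smallim`) and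
`Kato2004/MemberHullInputs.lean` (cell `bsd-potss`): ONE hypothesis STRUCTURE whose fields are the
printed statements about it RELATIVE TO PINNED OBJECTS, and ONE existence fact.  This file isolates
exactly the descent part of those packages — valid for EVERY elliptic curve `W/ℚ` and EVERY prime `p`
(`p = 2` included: see READING below), with no reduction, image or `L`-value hypothesis — so that the
definition `IsKatoDescentDatumOf W p D` can pin `(D.H2, D.A, D.ι, D.π)` THROUGH it and the realisability
reading (R) becomes a theorem over named facts instead of a free schema.  The field names and types of
the `A`-pin and of (14.14.1) are those of `MemberHullInputs` VERBATIM (so that package projects onto this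
one field by field).  Nothing is asserted; BSD is not advanced; no `_holds` is expected soon (size XL:
the construction of `𝐇²_Γ` with its `Λ`-structure and the long exact sequence in continuous étale
cohomology).

## The printed statements (K. Kato, Astérisque 295 (2004); `[p. N]` = printed page; store key
`paper:doi-10-24033-ast-639`, PDF page `N − 115`; read 2026-08-26)

* **§12.2 (12.2.1) [p. 220]** "Let `T` be a finitely generated `ℤ_p`-module endowed with a continuous
  action of `Gal(ℚ̄/ℚ)` which is unramified at almost all prime numbers. We denote for `q ∈ ℤ`
  `𝐇^q(T) = lim←_n H^q(ℤ[ζ_{p^n}, 1/p], T)` … The following are known: (12.2.1) `𝐇^q(T) = 0` if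
  `q ≠ 1, 2` and `𝐇¹(T)` and `𝐇²(T)` are finitely generated `ℤ_p[[G_∞]]`-modules."
* **Thm. 12.4 [p. 221]** "Take any `Gal(ℚ̄/ℚ)`-stable `O_λ`-lattice `T` of `V_{F_λ}`. Then: (1) `𝐇²(T)` is
  a torsion `Λ`-module. (2) `𝐇¹(T)` is a torsion free `Λ`-module …" (no hypothesis on `p`; proof §13.8
  [p. 227] for `f` without CM — "the fact `𝐇²(T)` is a torsion `Λ`-module follows from (12.8.2),
  Thm. 13.4 (1), and 13.7" — and §15 for CM forms; for CM by `K ⊂ ℚ(ζ_{p^∞})`, i.e. the tree's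
  consumer classes `(ℚ(ζ₄), 2)` / `(ℚ(ζ₃), 3)`, the road is 15.14–15.15, whose Rubin input at
  `p ∣ #μ(H_K)` lies outside [Ru2]'s standing hypothesis and is covered in refereed print by
  Johnson-Leung–Kings, J. reine angew. Math. 653 (2011) §7.2 as used by Burungale–Tian, Ann. of Math. 203
  (2026) Thm. 2.1 [store text `paper:burungale2025-rank-zero-p-converse-theorem-gross-zagier` p0004:L2–L10]
  — ARM P reader sheet `pub/bsd-cited/sheets/D-AUDIT-r01-S2.md` bc5f86ec8d2321e2 §4 / §6 (b)).  The
  `Λ ⊗ ℚ` form of Thm. 12.4 (1)(2) is restated in refereed print, for "`f ∈ S_k(Γ₁(N))` an elliptic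
  newform and `p` a prime", as Burungale–Tian 2026 Thm. 2.3 [ibid. p0004:L39–L42].
* **§13.8 [p. 228]** (the mechanism): "`H^q(ℤ[ζ_{p^n}, 1/p], T) ≅ H^q(ℤ[1/p], T ⊗_{O_λ} O_λ[G_n])` where
  `Gal(ℚ̄/ℚ)` acts on the tensor product … by `σ ⊗ σ_n^{-1}` … Hence `𝐇^q(T) = lim←_n H^q(ℤ[1/p], T ⊗
  O_λ[G_n])`", and for a non-zero-divisor `x` of `Λ` with `Λ/xΛ` `p`-torsion free "we have an exact
  sequence `𝐇⁰(T) → H⁰(ℚ, T ⊗_{O_λ} Λ/xΛ) → 𝐇¹(T) →x 𝐇¹(T)`" (the long exact sequence of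
  `0 → j_*(T ⊗ Λ) →x j_*(T ⊗ Λ) → j_*(T ⊗ Λ/xΛ) → 0`).
* **§14.14 [p. 243]** "Let `𝔭` be the kernel of the `O_λ`-homomorphism `Λ → O_λ` which sends `G_∞` to
  `1`. Since `Λ` is a finite product of regular local rings, `𝔭` is a principal ideal. Let `a` be a
  generator of `𝔭`. By the argument as in 13.8, we have an exact sequence
  **(14.14.1)** `0 → 𝐇¹(T)/a𝐇¹(T) → H¹(ℤ[1/p], T) → _a𝐇²(T) → 0` and an isomorphism
  **(14.14.2)** `𝐇²(T)/a𝐇²(T) ≅ H²(ℤ[1/p], T)`", where "`_a( )` denotes `Ker(a)`".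
* **§8.2 / Lemma 8.5 [pp. 180–184]** (`H¹(O_K[1/p], T) ↪ H¹(K, T)`; quoted in `IwasawaCohomology.lean`,
  whose `integralH1` is the tree's `H¹(ℤ_n[1/p], T_pW)`).

A. A. Burungale, C. Skinner, Appendix A to L. Alpöge–M. Bhargava–A. Shnidman, *Integers expressible as
the sum of two rational cubes*, arXiv:2210.10730 (store key `paper:arxiv-2210.10730`, pp. 33–34 of the
held text; read 2026-08-26) — the SAME objects over the cyclotomic `ℤ_p`-extension, for an
ARBITRARY elliptic curve over `ℚ` and an ARBITRARY prime (the standing hypotheses of this subsection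
are only its opening sentences, quoted first): **§10.1.1** "Let `E` be an elliptic curve over `ℚ`. For
a prime `p`, let `T` denote the `p`-adic Tate module of `E` and `V = T ⊗_{ℤ_p} ℚ_p`. Let `ℚ_∞` be the
cyclotomic `ℤ_p`-extension of `ℚ`, `Γ = Gal(ℚ_∞/ℚ)` and `Λ = ℤ_p[[Γ]]`. Fix a topological generator
`γ ∈ Γ`. … It is one of the main results of Kato [K] that `X_st(E)` (in the guise of
`H²(ℤ[1/p], T ⊗_{ℤ_p} Λ)`) is a finitely-generated torsion `Λ`-module. Let
`𝐳_E ∈ H¹(ℤ[1/p], T ⊗_{ℤ_p} Λ) ⊗_{ℤ_p} ℚ_p` denote the Beilinson–Kato element [K] and let `z_E ∈ H¹(ℚ, V)`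
be its image under the specialisation `γ ↦ 1`."  (Their §10.1.3 — "`Sel_st(E)` is finite. The same is
then true of `X_st(E)/(γ−1)X_st(E)`" — stands under "Let `E` be as in Theorem 10.1", i.e. CM and `p`
supersingular, and is NOT used in this file: see "What is NOT here".)

## The elliptic-curve specialisation, the PIN, and the READING (what the structure transcribes)

`T = T_pW` = the tree's continuous Tate module `tateRep W p` (`EulerSystemValues.lean`), a
`Gal(ℚ̄/ℚ)`-stable lattice of `V_{ℚ_p}(f_W)(1)` (`f_W` the newform of `W`, modularity; Thm. 12.4 holds
for every stable lattice and `𝐇^q(T(1)) ≅ 𝐇^q(T)(1)` along the cyclotomic tower, so (1) applies to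
`T_pW` — the reading already made by the tree's `Kato2004.thm12_4` for clause (2)).  `Λ = IwasawaAlgebra p
= ℤ_p⟦T⟧` with `T = γ − 1` for a cyclotomic `κ : ZpExtension ℚ p` with topological generator `γ`
(`κ.IsCyclotomic`, `κ.IsTopGenerator γ`), exactly as in `IwasawaH1Data`, `SelmerDualData`,
`FineSelmerDualData`.  The module transcribed is
  `𝐇²_Γ(T_pW) := lim←_n H²(ℤ_n[1/p], T_pW) = H²(ℤ[1/p], T_pW ⊗ ℤ_p⟦Γ⟧)`
(`ℤ_n` = integers of the `n`-th layer `ℚ_n` of `κ`; the equality is §13.8's Shapiro identity with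
`O_λ[G_n]` replaced by `ℤ_p[Γ/Γ^{p^n}]`) — Burungale–Skinner's "`H²(ℤ[1/p], T ⊗_{ℤ_p} Λ)`", `Λ = ℤ_p[[Γ]]`.
READING, two lines.  (i) `p` odd: `ℚ_n ⊂ ℚ(ζ_{p^{n+1}})` with `Δ = Gal(ℚ(ζ_{p^{n+1}})/ℚ_n)` of order
`p − 1` prime to `p`, so `𝐇²_Γ(T) = e₀·𝐇²(T)` is the `Δ`-trivial component of Kato's `𝐇²(T)` (a direct
summand; `cor ∘ res = p − 1`), finitely generated and torsion over `e₀ℤ_p[[G_∞]] = ℤ_p⟦T⟧` by (12.2.1)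
and Thm. 12.4 (1); and Kato's `𝔭 = (a)` restricted to `e₀Λ` is `(T)`, so (14.14.1) on the `Δ`-trivial
component reads `0 → 𝐇¹_Γ/T𝐇¹_Γ → H¹(ℤ[1/p], T) → 𝐇²_Γ[T] → 0` (`H^q(ℤ[1/p], T)` has trivial
`Δ`-action).  (ii) every `p`, `p = 2` INCLUDED (Burungale–Skinner §10.1.1, stated for an arbitrary
elliptic curve over `ℚ` and an arbitrary prime `p`): the
argument of §13.8 / §14.14 applies verbatim to `Λ_Γ = ℤ_p⟦Γ⟧ = ℤ_p⟦T⟧`, a regular local ring in which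
`𝔭 = Ker(Λ_Γ → ℤ_p, γ ↦ 1) = (T)` IS principal — the long exact cohomology sequence over `ℤ[1/p]` of
`0 → T_pW ⊗ Λ_Γ →(T) T_pW ⊗ Λ_Γ → T_pW → 0` gives (14.14.1)–(14.14.2) for `𝐇^q_Γ`; finite generation
is (12.2.1) for the `ℤ_p`-extension ([Pe3, §1.3], [Ta2]), and `𝐇²_Γ(T)` is `Λ_Γ`-torsion because the
corestriction `𝐇²(T) → 𝐇²_Γ(T)` from Kato's tower `ℚ(ζ_{p^∞}) ⊃ ℚ_∞` has image a quotient of the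
torsion module `𝐇²(T)` (Thm. 12.4 (1)) and cokernel killed by `[ℚ(ζ_{p^∞}) : ℚ_∞] = #μ(ℚ_p)`
(`cor ∘ res`), a finitely generated module killed by a non-zero constant.  For `p = 2` this is the
statement Burungale–Skinner print ("a finitely-generated torsion `Λ`-module", `Λ = ℤ_2[[Γ]]`).
Referee flag: `Kato-12.4(1)-14.14.1-Gamma-reading` (non-verbatim steps: the passage from Kato's
`G_∞`-tower to the `ℤ_p`-extension, (i)/(ii) above).

**The pin** (design = `MemberHullInputs`, fields VERBATIM).  `IwasawaH2Data W p κ γ I` for a pinned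
`I : IwasawaH1Data W p κ γ` is a HYPOTHESIS STRUCTURE:
* `H2` ABSTRACT = `𝐇²_Γ(T_pW)`: finitely generated ((12.2.1)) and torsion (Thm. 12.4 (1));
* `A` = `H¹(ℤ[1/p], T_pW)` PINNED to the tree's `integralH1 (tateRep W p) p (κ.layerSubgroup 0)` ⊆
  `H¹(ℚ, T_pW)` (§8.2 / Lemma 8.5 reading of `IwasawaCohomology.lean`) by an additive injection `toH1`
  with image `integralH1`, the `Λ`-structure through the augmentation `g ↦ g(0)` (`Λ` acts on
  `H¹(ℤ[1/p], T ⊗ Λ/𝔭)` through `Λ/𝔭 = ℤ_p`): `toH1 (g • a) = g(0) • toH1 a`;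
* (14.14.1) `0 → 𝐇¹_Γ/T𝐇¹_Γ →ι A →π H2[T] → 0` exact (`ι_injective`, `exact_ι_π`, `π_surjective`),
  with **`ι` PINNED to the level-`0` projection: `toH1 (ι (x mod T)) = I.proj 0 x`** (§13.8: the map
  is induced by `Λ → Λ/𝔭`, i.e. restriction to the bottom layer; tree `IwasawaH1Data.projZero`);
The rank-one finiteness "`rank_ℤ W(ℚ) = 1 ∧ #Ш(W)[p^∞] < ∞ ⟹ H2/T·H2` finite" (the road's binder
`h31`, reading (3.1')) is NOT a field of this package (review of the first filing, p459789: the sentence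
of Burungale–Skinner §10.1.3 that prints it stands under CM/supersingular hypotheses); it is a separate
named fact with its own sources (companion file `IwasawaH2DescentRankOne.lean`), stated on a package.
(14.14.2) is not a field: `H²(ℤ[1/p], T_pW)` (restricted ramification, degree `2`) is not a tree object
either, so `H2/T·H2` (`IwasawaAlgebra.coinvariants p H2`) is its DEFINITION here, as in
`MemberHullInputs` and `KatoDescentDatum.h2Card`.

EXISTENCE of the package for every `(W, p, κ, γ, I)` is the named fact `nonempty_iwasawaH2Data` below —
a CONSTRUCTION fact: its content is that Kato's genuine `𝐇²_Γ(T_pW)`, `H¹(ℤ[1/p], T_pW)` and the maps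
of (14.14.1) satisfy the listed printed statements; WEAKER than print (the identity of `H2` is
forgotten; only `H2[T]` is pinned, as the cokernel of `ι`), never stronger.  As for every
abstract-module package, a reader should know that witnesses for the abstract field could be
manufactured from consequences plus the pinned data; the content certified by review is the
TRANSCRIPTION, clause by clause (the same caveat as `DivisibilityInputs` / `MemberHullInputs`).

## What is here besides the structure and the fact (PROVED, elementary)

`toH1_mem` / `exists_eq_toH1_of_mem` (the pin of `A` unfolded), `X_smul_eq_zero` (`T` acts as `0` on
`A`), `toH1_ι_projZero` (`toH1 ∘ ι = projZero`), `projZero_injective` and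
`proj_zero_eq_zero_iff_mem_TSubmodule` — on a package, Kato's injectivity half of (14.14.1) read on the
pinned `𝐇¹_Γ`: **`proj₀ x = 0 ↔ x ∈ T·𝐇¹_Γ`** (the converse of the tree theorem
`IwasawaH1Data.proj_zero_eq_zero_of_mem_TSubmodule`).

## What is NOT here (scope; each line is a deliberate omission, not an oversight)

* NO identification of `𝐇²_Γ` with the dual FINE Selmer group `X₀(E/ℚ_∞)` (tree
  `WeierstrassCurve.FineSelmerDualData`): Poitou–Tate ((14.9.3) over `K = ℚ_n`, `n → ∞`, with (17.13.1))
  gives `0 → X₀(E/ℚ_∞) → 𝐇²_Γ → 𝐇²_{Γ,loc}` with `𝐇²_{Γ,loc} ≅ (E(ℚ_{∞,p})[p^∞])^∨` FINITE but in general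
  NON-ZERO (e.g. `E_n[2] ⊂ E_n(ℚ)` at `p = 2`), and Kato prints (14.9.3)/(14.9.4) "exact in the case
  `p ≠ 2`, and exact up to `×2` in the case `p = 2`" [p. 240] (the real places of the totally real
  `ℚ_∞`) — so an `≃ₗ[Λ]` pin `H2 ≃ X₀` would be FALSE to print, and at `p = 2` even "injective with
  finite cokernel" is not printed.  The road's readings do not need it: (3.1') is a statement about
  `H2/T·H2 = H²(ℤ[1/p], T_pW)` ((14.14.2) with (14.9.3) at `K = ℚ`; companion file), and
  (K) for CM curves (Burungale–Tian, Ann. of Math. 203 (2026) Thm. 2.6 = Burungale–Skinner Thm. 10.6) is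
  stated on `𝐇²` / `X_st` "in the guise of `𝐇²`" directly.
  -- TODO(general form): for `p ≠ 2` and `W` potentially good at `p`, the comparison
  -- `e : Y.X →ₗ[Λ] H2` injective with finite cokernel for `Y : W.FineSelmerDualData κ γ`
  -- [Kato (14.9.3) p. 240, (17.13.1) p. 279, (17.13.4); Kim AJM 148 §1.2.4], as a second package.
* NO pin of a zeta element in `I.H` (that is `IwasawaCohomologyZetaLift` / `…EulerSystemLift`, `p` odd;
  -- TODO(general form): the layer inclusion `Gal(ℚ̄/ℚ(μ_{2^{n+2}})) ≤ Gal(ℚ̄/ℚ_n)` for `p = 2`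
  so that `levelToLayer` and the zeta lift exist at `p = 2`), NO main conjecture, NO (14.14.2) beyond
  the definition above, NO `𝐇²_loc`, NO Poitou–Tate over `Λ`, NO proof of the fact.  No `instance`
  beyond the structure's own bundled fields; no notation.

## References

* K. Kato, *p-adic Hodge theory and values of zeta functions of modular forms*, Astérisque 295 (2004)
  117–290: §8.2 and Lemma 8.5 (pp. 180–184), §12.2 (12.2.1) (p. 220), Thm. 12.4 (p. 221), §13.8
  (pp. 227–228), (14.9.3)–(14.9.4) (p. 240), §14.14 (14.14.1)–(14.14.2) (p. 243) — read 2026-08-26 from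
  the store text `paper:doi-10-24033-ast-639`, pp. 105–129. [Kato2004Asterisque]
* A. A. Burungale, C. Skinner, Appendix A (§10) to L. Alpöge, M. Bhargava, A. Shnidman, *Integers
  expressible as the sum of two rational cubes*, arXiv:2210.10730: §10.1.1 (used), Thm. 10.1, Rem. 10.5
  (i), Thm. 10.6, §10.1.3 (context only) — read 2026-08-26 from the store text `paper:arxiv-2210.10730`,
  pp. 33–34.
  [AlpogeBhargavaShnidman2022]
* A. A. Burungale, Y. Tian, *A rank zero p-converse to a theorem of Gross–Zagier, Kolyvagin and Rubin*,
  Ann. of Math. (2) 203 (2026), Thm. 2.6 (cited through Burungale–Skinner Thm. 10.6); Thm. 2.3 (= Kato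
  Thm. 12.4 (1)(2) `⊗ ℚ`, "`p` a prime" — the REFEREED restatement beside the Burungale–Skinner preprint
  sentence) and Thm. 2.1 (equivariant main conjecture `⊗ ℚ` "after Johnson-Leung and Kings [11, §7.2]") —
  store text `paper:burungale2025-rank-zero-p-converse-theorem-gross-zagier` p0004, read 2026-08-27
  (ARM P `D-AUDIT-r01-S2.md` §6 (a)/(b)). [BurungaleTian2026]
* B. Perrin-Riou, Astérisque 229 (1995) §1.3 (= Kato's [Pe3]: (12.2.1)); J. Tate, [Ta2] Thm. 2.2 — cited
  through Kato.
* Tree: `Kato2004/IwasawaCohomology.lean` (`IwasawaH1Data`, `integralH1`, `nonempty_iwasawaH1Data`,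
  `thm12_4`), `Kato2004/IwasawaCohomologyLevelZero.lean` (`projZero`), `Kato2004/MemberHullInputs.lean`
  and `Kato2004/DivisibilityInputs.lean` (the templates), `IwasawaEulerCharProofs.lean` (`invariants`),
  `SelmerCorankControl.lean` (`coinvariants`); consumers (Summits side, not imported):
  `Rank1Residual/Additive/KatoDescentDatum.lean`, `Theorems/CongruentShaFreeCutKatoZetaRoad.lean`.
-/

noncomputable section

open Field
open Literature.NumberTheory.GaloisRepresentations
open Literature.NumberTheory.EllipticCurves Literature.NumberTheory.EllipticCurves.Kato2004
open Literature.NumberTheory.EllipticCurves.Kato2004.EulerSystemValues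
open Literature.NumberTheory.EllipticCurves.IwasawaAlgebra

namespace Literature.NumberTheory.EllipticCurves.Kato2004

section Package

variable (W : WeierstrassCurve ℚ) [W.IsElliptic] (p : ℕ) [Fact p.Prime]
  [ContinuousSMul ℤ_[p] (W.tateModule p)] (κ : ZpExtension ℚ p) (γ : absoluteGaloisGroup ℚ)
  (I : IwasawaH1Data W p κ γ)

/-- **Kato's `𝐇²_Γ(T_pW)` with its descent sequence, on the pinned pair (`𝐇¹_Γ(T_pW)`,
`H¹(ℤ[1/p], T_pW)`) — hypothesis structure (a package of printed statements; nothing asserted).**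
For an elliptic curve `W/ℚ`, a prime `p`, a cyclotomic `ℤ_p`-extension datum `κ` with topological
generator `γ` and a pinned Iwasawa cohomology `I : IwasawaH1Data W p κ γ`: the ABSTRACT `Λ`-module
`H2 = 𝐇²_Γ(T_pW) = lim←_n H²(ℤ_n[1/p], T_pW)`, finitely generated ((12.2.1)) and torsion (Thm. 12.4 (1));
the module `A = H¹(ℤ[1/p], T_pW)` PINNED to `integralH1 (tateRep W p) p (κ.layerSubgroup 0)` by `toH1`,
with `Λ` acting through the augmentation; the exact sequence (14.14.1)
`0 → 𝐇¹_Γ/T𝐇¹_Γ →ι A →π H2[T] → 0` with `ι` PINNED to `proj₀`.  Nothing else: every field is one of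
Kato's (12.2.1) / Thm. 12.4 (1) / (14.14.1) / Lemma 8.5 statements for `T = T_pW` (Burungale–Skinner
§10.1.1 for the cyclotomic `ℤ_p`-extension form, arbitrary `E/ℚ` and `p`).  Field names and types agree
with `MemberHullInputs` (module docstring, READING (i)/(ii) for the passage from Kato's `G_∞`-tower to the
`ℤ_p`-extension, `p = 2` included).
[cite: Kato2004Asterisque, §12.2 (12.2.1) (p. 220), Thm. 12.4 (1) (p. 221), §13.8 (p. 228), §14.14 (14.14.1) (p. 243), §8.2 and Lemma 8.5 (pp. 180–184)]
[cite: AlpogeBhargavaShnidman2022, App. A §10.1.1] -/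
structure IwasawaH2Data : Type 1 where
  /-- `H2 = 𝐇²_Γ(T_pW)`, abstract. -/
  H2 : Type
  [addCommGroupH2 : AddCommGroup H2]
  [moduleH2 : _root_.Module (IwasawaAlgebra p) H2]
  /-- (12.2.1): `𝐇²_Γ(T_pW)` is a finitely generated `Λ`-module. -/
  finite_H2 : Module.Finite (IwasawaAlgebra p) H2
  /-- Thm. 12.4 (1): `𝐇²_Γ(T_pW)` is a torsion `Λ`-module. -/
  isTorsion_H2 : Module.IsTorsion (IwasawaAlgebra p) H2
  /-- `A = H¹(ℤ[1/p], T_pW)` as a `Λ`-module (through the augmentation), pinned by `toH1`. -/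
  A : Type
  [addCommGroupA : AddCommGroup A]
  [moduleA : _root_.Module (IwasawaAlgebra p) A]
  /-- The PIN of `A`: an additive map to `H¹(ℚ, T_pW)` at the bottom layer `κ.layerSubgroup 0 = Γ_ℚ` … -/
  toH1 : A →+ H1 (tateRep W p) (κ.layerSubgroup 0)
  /-- … injective … -/
  toH1_injective : Function.Injective toH1
  /-- … with image exactly the integral classes `H¹(ℤ[1/p], T_pW)` (§8.2, Lemma 8.5) … -/
  mem_range_toH1_iff : ∀ x : H1 (tateRep W p) (κ.layerSubgroup 0),
    x ∈ Set.range toH1 ↔ x ∈ integralH1 (tateRep W p) p (κ.layerSubgroup 0)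
  /-- … and `Λ` acting on `A` through the augmentation `g ↦ g(0)` (so `T` acts as `0`). -/
  toH1_smul : ∀ (g : IwasawaAlgebra p) (a : A), toH1 (g • a) = PowerSeries.constantCoeff g • toH1 a
  /-- (14.14.1), first map `𝐇¹_Γ/T𝐇¹_Γ → H¹(ℤ[1/p], T_pW)`. -/
  ι : coinvariants p I.H →ₗ[IwasawaAlgebra p] A
  /-- (14.14.1), second map `H¹(ℤ[1/p], T_pW) → 𝐇²_Γ[T]`. -/
  π : A →ₗ[IwasawaAlgebra p] invariants p H2
  /-- (14.14.1): `ι` injective. -/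
  ι_injective : Function.Injective ι
  /-- (14.14.1): `π` surjective. -/
  π_surjective : Function.Surjective π
  /-- (14.14.1): exact in the middle. -/
  exact_ι_π : Function.Exact ι π
  /-- The PIN of `ι`: `ι(x mod T) = proj₀ x` in `H¹(ℚ, T_pW)` (§13.8 / (14.14.1): the map is induced by
  `Λ → Λ/𝔭`, i.e. the projection to the bottom layer; `IwasawaH1Data.projZero`). -/
  toH1_ι : ∀ x : I.H, toH1 (ι (Submodule.Quotient.mk x)) = I.proj 0 x

attribute [instance] IwasawaH2Data.addCommGroupH2 IwasawaH2Data.moduleH2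
  IwasawaH2Data.addCommGroupA IwasawaH2Data.moduleA

end Package

namespace IwasawaH2Data

variable {W : WeierstrassCurve ℚ} [W.IsElliptic] {p : ℕ} [Fact p.Prime]
  [ContinuousSMul ℤ_[p] (W.tateModule p)] {κ : ZpExtension ℚ p} {γ : absoluteGaloisGroup ℚ}
  {I : IwasawaH1Data W p κ γ} (J : IwasawaH2Data W p κ γ I)

/-- The values of `toH1` are integral classes `H¹(ℤ[1/p], T_pW)` (the pin of `A`, one direction).
[cite: Kato2004Asterisque, §8.2 and Lemma 8.5 (pp. 180–184)] -/
theorem toH1_mem (a : J.A) : J.toH1 a ∈ integralH1 (tateRep W p) p (κ.layerSubgroup 0) :=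
  (J.mem_range_toH1_iff _).mp ⟨a, rfl⟩

/-- Every integral class at level `0` is a value of `toH1` (the pin of `A`, other direction).
[cite: Kato2004Asterisque, §8.2 and Lemma 8.5 (pp. 180–184)] -/
theorem exists_eq_toH1_of_mem {x : H1 (tateRep W p) (κ.layerSubgroup 0)}
    (hx : x ∈ integralH1 (tateRep W p) p (κ.layerSubgroup 0)) : ∃ a : J.A, J.toH1 a = x :=
  (J.mem_range_toH1_iff x).mpr hx

/-- `T ∈ Λ` acts as `0` on `A = H¹(ℤ[1/p], T_pW)` (the `Λ`-structure is through `Λ → Λ/𝔭 = ℤ_p`).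
[cite: Kato2004Asterisque, §14.14 (p. 243)] -/
theorem X_smul_eq_zero (a : J.A) : (PowerSeries.X : IwasawaAlgebra p) • a = 0 := by
  apply J.toH1_injective
  rw [J.toH1_smul, PowerSeries.constantCoeff_X, zero_smul, map_zero]

/-- `A` is killed by `T`: every element of `A` lies in the `Γ`-invariants `A[T]`. [cite: Kato2004Asterisque, §14.14 (p. 243)] -/
theorem mem_invariants (a : J.A) : a ∈ invariants p J.A :=
  (mem_invariants_iff p J.A a).mpr (J.X_smul_eq_zero a)

/-- **`toH1 ∘ ι = proj₀`**: the first map of (14.14.1), read in `H¹(ℚ, T_pW)`, is the tree's level-`0`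
projection `IwasawaH1Data.projZero` out of the coinvariants. [cite: Kato2004Asterisque, §14.14 (14.14.1) (p. 243) and §13.8 (p. 228)] -/
theorem toH1_ι_projZero (x : coinvariants p I.H) : J.toH1 (J.ι x) = I.projZero x := by
  induction x using Submodule.Quotient.induction_on with
  | H y => rw [J.toH1_ι, IwasawaH1Data.projZero_mk]

/-- On a package, **`proj₀ : 𝐇¹_Γ/T𝐇¹_Γ → H¹(ℚ, T_pW)` is injective** — the injectivity half of
(14.14.1) transported to the pinned `𝐇¹_Γ(T_pW)` (`proj₀ = toH1 ∘ ι`, both injective).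
[cite: Kato2004Asterisque, §14.14 (14.14.1) (p. 243)] -/
theorem projZero_injective (J : IwasawaH2Data W p κ γ I) : Function.Injective I.projZero := by
  intro x y h
  apply J.ι_injective
  apply J.toH1_injective
  rw [J.toH1_ι_projZero, J.toH1_ι_projZero, h]

/-- On a package, **`proj₀ x = 0 ↔ x ∈ T·𝐇¹_Γ`** for `x ∈ 𝐇¹_Γ(T_pW)`: the kernel of the projection to
the bottom layer is exactly `T·𝐇¹_Γ` — Kato's `𝐇¹(T)/a𝐇¹(T) ↪ H¹(ℤ[1/p], T)` of (14.14.1); the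
direction `←` is the unconditional tree theorem `IwasawaH1Data.proj_zero_eq_zero_of_mem_TSubmodule`.
[cite: Kato2004Asterisque, §14.14 (14.14.1) (p. 243)] -/
theorem proj_zero_eq_zero_iff_mem_TSubmodule (J : IwasawaH2Data W p κ γ I) (x : I.H) :
    I.proj 0 x = 0 ↔ x ∈ TSubmodule p I.H := by
  rw [← Submodule.Quotient.mk_eq_zero, ← IwasawaH1Data.projZero_mk]
  exact ⟨fun h ↦ J.projZero_injective (by rw [h, map_zero]), fun h ↦ by rw [h, map_zero]⟩

/-- The kernel of `π : A → 𝐇²_Γ[T]` is the image of `𝐇¹_Γ/T𝐇¹_Γ` (exactness of (14.14.1), unfolded).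
[cite: Kato2004Asterisque, §14.14 (14.14.1) (p. 243)] -/
theorem π_eq_zero_iff (a : J.A) : J.π a = 0 ↔ a ∈ Set.range J.ι :=
  J.exact_ι_π a

/-- `𝐇²_Γ[T] ≅ A/ι(𝐇¹_Γ/T𝐇¹_Γ)`: the third term of (14.14.1) is PINNED as the cokernel of `ι` (so the
package determines `H2[T]`, though not `H2`). [cite: Kato2004Asterisque, §14.14 (14.14.1) (p. 243)] -/
def invariantsEquivCoker : (J.A ⧸ LinearMap.range J.ι) ≃ₗ[IwasawaAlgebra p] invariants p J.H2 :=
  (LinearMap.range J.ι).quotEquivOfEq (LinearMap.ker J.π) (LinearMap.exact_iff.mp J.exact_ι_π).symm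
    ≪≫ₗ J.π.quotKerEquivOfSurjective J.π_surjective

/-- Unfolding `invariantsEquivCoker` on a class. [cite: Kato2004Asterisque, §14.14 (14.14.1) (p. 243)] -/
@[simp] theorem invariantsEquivCoker_mk (a : J.A) :
    J.invariantsEquivCoker (Submodule.Quotient.mk a) = J.π a :=
  rfl

end IwasawaH2Data

/-! ## The named fact: the package exists (Kato (12.2.1), Thm. 12.4 (1), §14.14 for `T = T_pW` along
the cyclotomic `ℤ_p`-extension; Burungale–Skinner §10.1.1) -/

/-- **Kato 2004, (12.2.1) (p. 220), Thm. 12.4 (1) (p. 221) and §14.14 (14.14.1) (p. 243, "by the argument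
as in 13.8"), for `T = T_pW` along the cyclotomic `ℤ_p`-extension — with Burungale–Skinner, App. A to
arXiv:2210.10730, §10.1.1 ("Let `E` be an elliptic curve over `ℚ`. For a prime `p` … `X_st(E)` (in
the guise of `H²(ℤ[1/p], T ⊗_{ℤ_p} Λ)`) is a finitely-generated torsion `Λ`-module", `Λ = ℤ_p[[Γ]]`,
arbitrary `E/ℚ` and `p`): Kato's `𝐇²_Γ(T_pW)` WITH ITS DESCENT SEQUENCE EXISTS on the pinned pair.**  For every elliptic curve `W/ℚ`, every prime `p`, every cyclotomic
`ℤ_p`-extension datum `κ` with topological generator `γ` and every pinned Iwasawa cohomology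
`I : IwasawaH1Data W p κ γ`, the structure `IwasawaH2Data W p κ γ I` is inhabited — by
`𝐇²_Γ(T_pW) = lim←_n H²(ℤ_n[1/p], T_pW)`, by `H¹(ℤ[1/p], T_pW)` with its inclusion into `H¹(ℚ, T_pW)`
(Lemma 8.5), and by the maps of the long exact cohomology sequence of
`0 → T_pW ⊗ Λ →(T) T_pW ⊗ Λ → T_pW → 0` over `ℤ[1/p]` (§13.8).  A CONSTRUCTION fact (D-0014):
weaker than print (the identity of `H2` is forgotten; `H2[T]` is pinned as `coker ι`), never stronger;
module docstring READING (i)/(ii) for the `Δ`-component / `ℤ_p`-extension passage (`p = 2` included,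
as Burungale–Skinner print it).  Consumers: the definition `IsKatoDescentDatumOf` and the realisability reading (R) of
`Theorems/CongruentShaFreeCutKatoZetaRoad.lean` (cell `bsd-cn100`); with `nonempty_iwasawaH1Data` and
`thm12_4` it supplies the `H`- and `H2`-sides of `Rank1Residual.Additive.KatoDescentDatum`.  Named fact;
nothing asserted; no `_holds` expected (size XL).  Referee flag: `Kato-12.4(1)-14.14.1-Gamma-reading`.
-- TODO(general form): Kato's `𝐇²(T)` over `Λ = O_λ[[G_∞]]` for every stable lattice `T` of `V_{F_λ}(f)`
-- (weight `k ≥ 2`, coefficients, all `Δ`-components), CONSTRUCTED (degree-2 corestriction / continuous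
-- étale cohomology of `ℤ[1/p]`) rather than packaged, with (14.14.2) and the Poitou–Tate comparison to
-- `WeierstrassCurve.FineSelmerDualData` (`p ≠ 2`).
See also, as the REFEREED restatement of the `Λ ⊗ ℚ` form of Thm. 12.4 (1)(2) ("`f` an elliptic
newform and `p` a prime") beside the Burungale–Skinner preprint sentence: Burungale–Tian, Ann. of Math.
203 (2026), Thm. 2.3 (ARM P reader sheet `pub/bsd-cited/sheets/D-AUDIT-r01-S2.md` bc5f86ec8d2321e2 §6 (a);
statement VERBATIM-COMPOSITE there, doc item only).
[cite: Kato2004Asterisque, §12.2 (12.2.1) (p. 220), Thm. 12.4 (1) (p. 221), §13.8 (p. 228), §14.14 (14.14.1)–(14.14.2) (p. 243), §8.2 and Lemma 8.5 (pp. 180–184)]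
[cite: AlpogeBhargavaShnidman2022, App. A §10.1.1]
[cite: BurungaleTian2026, Thm. 2.3 (refereed restatement of Kato Thm. 12.4 (1)(2) ⊗ ℚ, any prime p)] -/
def nonempty_iwasawaH2Data : Prop :=
  ∀ (W : WeierstrassCurve ℚ) [W.IsElliptic] (p : ℕ) [Fact p.Prime]
    [ContinuousSMul ℤ_[p] (W.tateModule p)] (κ : ZpExtension ℚ p) (γ : absoluteGaloisGroup ℚ),
    κ.IsCyclotomic → κ.IsTopGenerator γ → ∀ I : IwasawaH1Data W p κ γ, Nonempty (IwasawaH2Data W p κ γ I)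

/-- Consumer shape of the fact, the injectivity half of (14.14.1) on the pinned `𝐇¹_Γ(T_pW)` with no
package in sight: under `nonempty_iwasawaH2Data`, **`proj₀ x = 0 ↔ x ∈ T·𝐇¹_Γ`** for every cyclotomic
`κ`, topological generator `γ`, `I : IwasawaH1Data W p κ γ` and `x ∈ I.H`.
[cite: Kato2004Asterisque, §14.14 (14.14.1) (p. 243)] -/
theorem proj_zero_eq_zero_iff_mem_TSubmodule_of_nonempty (h : nonempty_iwasawaH2Data)
    (W : WeierstrassCurve ℚ) [W.IsElliptic] (p : ℕ) [Fact p.Prime]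
    [ContinuousSMul ℤ_[p] (W.tateModule p)] {κ : ZpExtension ℚ p} {γ : absoluteGaloisGroup ℚ}
    (hκ : κ.IsCyclotomic) (hγ : κ.IsTopGenerator γ) (I : IwasawaH1Data W p κ γ) (x : I.H) :
    I.proj 0 x = 0 ↔ x ∈ TSubmodule p I.H := by
  obtain ⟨J⟩ := h W p κ γ hκ hγ I
  exact J.proj_zero_eq_zero_iff_mem_TSubmodule x

end Literature.NumberTheory.EllipticCurves.Kato2004

end
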